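import Summits.HodgeConjecture.HodgeConjecture.Cruxes.H413.Lines.F0_U3LettersRung1KitC
import Summits.HodgeConjecture.HodgeConjecture.Cruxes.H413.Lines.F0_U3LettersRung1Defs          -- companion ED. 4 «#175 PINNED» (`Rung0WitnessS.hSET` AT `Δ‴(μω)`); ED. 3 (af5b824eed5e58b2): `kitK9S` := ★1 `kitOfRecordW … μω wXi c …`, `OverrideWitnessS … c wXi …`, `Rung0WitnessS` (+ `wXi`, `hw`) — closer ED. 38 «PK-ε»
import Summits.HodgeConjecture.HodgeConjecture.Cruxes.H413.Lines.F0_U3LettersRung1KitRung0      -- ED. 7 «#175 PINNED» (producer fed by ★ T1 twin); ED. 6 «CHOICE CARRIES PINS» (closer ED. 41): `StubRung0SPinned` (KitRung0 ED. 6) — the pinned producer՚s hypothesis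
import Summits.HodgeConjecture.HodgeConjecture.Theorems.F0P3KitFamilyOfRecordW        -- ED. 3: ★6 (w1) (F0P2-p02 (g12)) `F0P3KitOfRecordW.FrameDataW` (★ `FrameData` + field `wXi`), `kitFamilyOfRecordW`
import Summits.HodgeConjecture.HodgeConjecture.Theorems.F0P3KitOfRecordWTransport  -- ED. 3: ★1b p847021 `F0P3KitOfRecordW.unitaryPacket_kitOfRecordW_of` (★7 «UP-W», row #10 at the W kit) + the sign-blind `…_kitOfRecordW_iff` transports
import HarnessLib

/-!
# `F0_U3LettersRung1KitD` — KIT D of the RUNG-1 LINE `F0_U3LettersRung1` after the «SPLIT» (cell rule s937 (R2) «split the monster per letter behind a thin registered aggregator»; desk D47 (4); LEAD T10-35; REF1 (g24) m09 (R-1)–(R-7); registrar m07; pen F0P3-p04 (g12) proposal v0 4edaab76ecd27ca7, generator `work/ed34/mk_split.py` on the closer ED. 33 of record c227472e30be8b7b).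
EDITION 7 (2026-09-03, «#175 PINNED» — closer ED. 44; director g36 s1830 ORDER; heir LEAD F0P3a-plan (g19) T18-10 «#175-R SCOPE» (1)(b)(c) T3∕T4 ∕ T18-13 (3); desk F0P3-plan (g22) D-O7∕D-O7b;
K2E4-r01 (g0) O7 VERDICT 9d20d85d782e07ce; registrar A-plan1 (g34) pen; base ED. 6 5142d5e952280fbb).  WHAT CHANGES: (i) `Kit.nonempty_rung0Choice_of_pinned` draws the pinned kit from the
T1-API ed. 1.26 export ★ `anchoredKit_nonempty_of_stubsQ_loc_pinned` — the ed. 1.25 export with the singular package `hSET` AT ONE finite collection `Δ₀` and the pin `hQΔ : Q Δ mH mG → Δ = Δ₀` —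
at `Δ₀ := finExplicitCollection L H μω (finExplicitDelta_conj_left_all L H μω) (finExplicitDelta_conj_right_all L H μω)` (print՚s `Δ‴(μω)` [Rogawski1990 §4.9 p. 55]) and `hQΔ := fun _ _ _ h => h.1`
(the first conjunct of `StubRung0SPinned`՚s rider «`Δ = Δ‴ ∧ Q_K9S …`»), reading the re-typed field `W.hSET : SingularEllipticTransferCanonicalAtDelta L H W.Tinf Δ‴(μω) …` of Defs ED. 4; the two
extra arguments are the whole diff of the call, the rest of the body byte-identical; (ii) `Kit.nonempty_rung0Choice_of` (UNPINNED, over `StubRung0S`, through the `∀ Δ` export) is DROPPED with its only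
consumer, the aggregator՚s `nonempty_rung0Choice` (closer ED. 44; nothing downstream reads it).  UNCHANGED BYTE-FOR-BYTE: `Rung0Choice`, `Rung0ChoicePinned`, `frameData`, `rows_of`, every
other declaration.  NO `sorry`, NO registered row.

EDITION 3 (2026-09-01; closer ED. 38 «PK-ε» — desk F0P3-plan (g12) RULING D53-pre A(3)(4) + (9)(10)(11), census B1 (d) 9c22b97a2bccd400; pen of record F0P3-p04 (g13), generator `work/ed38/mk_ed38_kitd.py` over the tree ED. 2 bytes 175cb783f947f989): the rung-0 choice AT THE W KIT — `Rung0Choice.OW : OverrideWitnessS … W.c W.wXi W.jInf W.dsInf …` (text of `Rung0Choice`∕`Kit.nonempty_rung0Choice_of` otherwise unchanged: `W : Rung0WitnessS …` carries `wXi`∕`hw` since Defs ED. 3), `Rung0Choice.frameData : F0P3KitOfRecordW.FrameDataW …` (★6 (w1): ★ `FrameData` + the field `wXi := C.W.wXi`), `Rung0Choice.kitOfRecord_frameData_eq : kitOfRecordW ‹frameData› = kitK9S … (rfl)`, `Rung0Choice.kit := kitK9S … C.W.c C.W.wXi …` (= ★1 `kitOfRecordW …`), `Rung0Choice.rows_of`: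 the fourteen rows AT THE W KIT — `specPkg` from `C.OW` (sign-BEARING, W-typed since Defs ED. 3), #10 `UnitaryPacket` by ★1b `F0P3KitOfRecordW.unitaryPacket_kitOfRecordW_of` (★7 «UP-W», sign-BEARING), every other row by the SAME ★ `…_kitOfRecord…` term as ED. 2 (sign-BLIND: the structure-update defeq of ★1 carries them — F0P3-p03 (g14) probe 5ada654d0190fa95; ★1b `…_kitOfRecordW_iff := Iff.rfl` names the transports).  NO `sorry`, NO registered row. [cite: Rogawski1992, Thm. 1.2 p. 397]

EDITION 1 (2026-09-01).  CONTENT: BYTE-VERBATIM from the closer ED. 33 §D∕§D.2: `structure Rung0Choice` (:1103–:1158), `Rung0Choice.frameData` (:1211–:1235), `Rung0Choice.kitOfRecord_frameData_eq` (:1237–:1245),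
`abbrev Rung0Choice.kit` (:1284–:1287); NEW in FUNCTION FORM: `Kit.nonempty_rung0Choice_of (h0 : StubRung0S) …` (= `nonempty_rung0Choice`՚s body, `stub_rung0` a binder) and
`Rung0Choice.rows_of (hL3 : F0P3CohClassRoutingCot.CohClassRoutingCotClosed) …` (= `Rung0Choice.rows`՚ body, `stub_L3` a binder).  Imports KIT C (`stub_Keys`, `stub_79` appear in the types).
The cone decls `nonempty_rung0Choice`, `rung0Choice`, `Rung0Choice.rows` keep NAME + TEXT in the aggregator as one-liners.  NO `sorry`, NO registered row, no `instance`, no notation.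
HONEST LABEL: engineering only — nothing is discharged by the split; HC_CM is proved only modulo the 2 remaining named inputs (hLiu418, h413) until rung 0 closes.
-/

set_option autoImplicit false
set_option linter.dupNamespace false

noncomputable section

namespace Summit.HodgeConjecture.HodgeConjecture.Cruxes.H413.F0U3LettersRung1

open MeasureTheory NumberField IsDedekindDomain
open Literature.NumberTheory.Automorphic Literature.NumberTheory.Automorphic.UnitaryGroup
open Literature.NumberTheory.Rogawski1990 Literature.NumberTheory.GaloisRepresentations
open Summit.HodgeConjecture.HodgeConjecture.Cruxes.H413
open Summit.HodgeConjecture.HodgeConjecture.Cruxes.H413.F0T1InnerFormTraceIdentity (ComparisonKit SpecOverride GpAdelic GpLocal HLocal GpInf GInf HInf IsAnisotropic IsHermitianCM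
  stub_T1c_splitFormAutomorphicMeasure anchoredKit_nonempty_of_stubsQ)
open Summit.HodgeConjecture.HodgeConjecture.Cruxes.H413.F0P3InnerFormClassificationV6 (Gp Places Cinf EvpData)
open Summit.HodgeConjecture.HodgeConjecture.Cruxes.H413.F0P3KitOfRecord (kitOfRecord GHSide socketsOfT1 FrameData kitFamilyOfRecord letters_of_specPkgV8
  traceIdentity_kitOfRecord_override)
open Summit.HodgeConjecture.HodgeConjecture.Cruxes.H413.F0P3XiSideOfRecord (xiSideOfRecord xiFamilyFin_kitOfRecord xiUnram_kitOfRecord_of_xiPinSphericalCofinite evpConvention_kitOfRecord)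
open Summit.HodgeConjecture.HodgeConjecture.Cruxes.H413.F0P3XiPacketFamilyOfRecord (keysOfKeysCaseTwo hCM_of_cmCharIdentityPackage hexc_of_xiPinSphericalCofinite)
open Summit.HodgeConjecture.HodgeConjecture.Cruxes.H413.F0P3XiArchPacketOfRecord (JInfNoDegOne DsInfNoDegOne)
open Summit.HodgeConjecture.HodgeConjecture.Cruxes.H413.F0P3UnitaryLocOfRecord (IsCohUnitaryClass)
open Summit.HodgeConjecture.HodgeConjecture.Cruxes.H413.F0P3LettersTraceFactorisation (IsProductHaar)
open scoped Matrix ComplexOrder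

section D

variable (L : Type) [Field L] [NumberField L] [IsCMField L] (ι : L →+* ℂ) (H : Matrix (Fin 3) (Fin 3) L) (T : GL (Fin 3) ℂ)
  (hT : (T : Matrix (Fin 3) (Fin 3) ℂ)ᴴ * H.map ι * (T : Matrix (Fin 3) (Fin 3) ℂ) = Literature.Geometry.ComplexHyperbolic.BallModel.J)
  (μ : Measure (Gp L H).automorphicQuotient) [(Gp L H).IsAutomorphicMeasure μ] (μω : HeckeCharacter L) (hμu : μω.IsUnitary)
  (hμω : ∀ x : Literature.NumberTheory.GaloisRepresentations.ideleGroup ↥(maximalRealSubfield L), μω (AdeleRing.ideleBaseChange (↥(maximalRealSubfield L)) L x) = quadraticHeckeCharCM L x)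

/-- **THE RUNG-0 CHOICE AT ONE FRAME** — the data §D chooses ONCE per frame (R-21 (iii)): the `Rung0WitnessS` `W` of `stub_rung0`, the pinned comparison kit `𝔨` WITH PARTNERS
that the T1 export ★ `anchoredKit_nonempty_of_stubsQ` hands for `W`'s package, the export's `G`-side orbital family `mG₀` (agreeing with `𝔨.mG` on the regular classes), the
proof `hQ` of `Q_K9S`'s first conjunct at `(𝔨.Δ, 𝔨.mH, mG₀)`, and the `OverrideWitnessS` `OW` of `Q_K9S`'s second conjunct at the kit `𝔨` and the letters Keys ∕ #79.  DATA with proofs;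
`Nonempty` below, then `Classical.choice`. [cite: Rogawski1990, §14.6 Thm. 14.6.1 p. 241; Thm. 14.6.4 p. 244] -/
structure Rung0Choice : Type 2 where
  /-- the rung-0 witness of `stub_rung0` -/
  W : Rung0WitnessS L ι H T hT μ μω hμu hμω
  /-- T1's pinned anchor kit (with partners and the simple trace formula) -/
  𝔨 : ComparisonKit L H μ
  /-- the export's `G`-side orbital measure family -/
  mG₀ : letI : ∀ (v : Places L) (γ : (cmDatum L 3 H).Local v),
      MeasurableSpace ((cmDatum L 3 H).Local v ⧸ Subgroup.centralizer ({γ} : Set ((cmDatum L 3 H).Local v))) := fun _ _ => borel _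
    ∀ v : Places L, OrbitalMeasureFamily ((cmDatum L 3 H).Local v)
  /-- `𝔨` is pinned at `W`'s measures and transfer factor -/
  hpin : letI : MeasurableSpace (GpAdelic L H) := borel _
    haveI : BorelSpace (GpAdelic L H) := ⟨rfl⟩
    haveI : W.ν.IsHaarMeasure := W.isHaar_ν
    haveI : W.ν.IsInvInvariant := W.isInvInv_ν
    letI : ∀ v : Places L, MeasurableSpace (GpLocal L H v) := fun _ => borel _
    haveI : ∀ v : Places L, BorelSpace (GpLocal L H v) := fun _ => ⟨rfl⟩
    letI : ∀ v : Places L, MeasurableSpace (HLocal L v) := fun _ => borel _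
    haveI : ∀ v : Places L, BorelSpace (HLocal L v) := fun _ => ⟨rfl⟩
    letI : ∀ (v : Places L) (a : HLocal L v), MeasurableSpace (HLocal L v ⧸ Subgroup.centralizer ({a} : Set (HLocal L v))) := fun _ _ => borel _
    letI : ∀ (v : Places L) (γ : GpLocal L H v), MeasurableSpace (GpLocal L H v ⧸ Subgroup.centralizer ({γ} : Set (GpLocal L H v))) := fun _ _ => borel _
    letI : MeasurableSpace (GpInf L H) := borel _
    haveI : BorelSpace (GpInf L H) := ⟨rfl⟩
    letI : MeasurableSpace (GInf L) := borel _
    haveI : BorelSpace (GInf L) := ⟨rfl⟩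
    letI : MeasurableSpace (HInf L) := borel _
    haveI : BorelSpace (HInf L) := ⟨rfl⟩
    haveI : ∀ v : Places L, (W.νH v).IsHaarMeasure := W.isHaar_νH
    haveI : ∀ v : Places L, (W.νH v).IsMulRightInvariant := W.isRightInv_νH
    haveI : ∀ v : Places L, (W.νG v).IsHaarMeasure := W.isHaar_νG
    haveI : ∀ v : Places L, (W.νG v).IsMulRightInvariant := W.isRightInv_νG
    haveI : IsFiniteMeasureOnCompacts W.νGi := W.finCpt_νGi
    haveI : W.νGi.IsMulRightInvariant := W.rightInv_νGi
    haveI : IsFiniteMeasureOnCompacts W.νqi := W.finCpt_νqi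
    haveI : W.νqi.IsMulRightInvariant := W.rightInv_νqi
    haveI : IsFiniteMeasureOnCompacts W.νHi := W.finCpt_νHi
    haveI : W.νHi.IsMulRightInvariant := W.rightInv_νHi
    𝔨.IsPinned W.ν W.Tinf W.νH W.νG W.νGi W.νqi W.νHi
  /-- law T1g at `𝔨` -/
  htE : 𝔨.TransferExistence
  /-- law T1a at `𝔨` -/
  hSTF : 𝔨.SimpleTraceFormula
  /-- `Q_K9S`'s first conjunct at `(𝔨.Δ, 𝔨.mH, mG₀)` [Rogawski1990, Prop. 13.1.4] -/
  hQ : letI : ∀ v : Places L, MeasurableSpace (GpLocal L H v) := fun _ => borel _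
    letI : ∀ v : Places L, MeasurableSpace (HLocal L v) := fun _ => borel _
    letI : ∀ (v : Places L) (a : HLocal L v), MeasurableSpace (HLocal L v ⧸ Subgroup.centralizer ({a} : Set (HLocal L v))) := fun _ _ => borel _
    letI : ∀ (v : Places L) (γ : GpLocal L H v), MeasurableSpace (GpLocal L H v ⧸ Subgroup.centralizer ({γ} : Set (GpLocal L H v))) := fun _ _ => borel _
    CMCharIdentityPackageTestSigned L H (transpose_map_cmConjRingHom_eq_of_frame L ι H T hT) (isUnit_det_of_frame L ι H T hT) W.νH W.νG μω hμu 𝔨.Δ 𝔨.mH mG₀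
  /-- `Q_K9S`'s second conjunct, eliminated at `𝔨` and the letters Keys ∕ #79 -/
  OW : OverrideWitnessS L ι H T hT μ μω hμu W.ν W.νH W.νG W.νGi W.μZ W.c W.wXi W.jInf W.dsInf W.isHaar_ν W.isHaar_μZ
    (fun v _ => isQuadraticCharExtension_semilocalComponent_of_baseChange_eq μω hμω v) 𝔨.Δ 𝔨.mH mG₀ hQ
    (stub_Keys L) (stub_79 L) 𝔨

/-- **THE RUNG-0 CHOICE, PINNED** (KitD ED. 6 «CHOICE CARRIES PINS» — closer ED. 41 «Δ‴-PINS EXPOSED», LEAD F0P3a-plan (g13) T12-35∕T12-36∕T12-37, desk F0P3-plan (g14)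
D69″∕D69‴∕D69⁗; LHref-S (g2) BOX LH10 #3 «DAY-X DRESS REHEARSAL» (G1)(G2b)(G3)): the `Rung0Choice` of record EXTENDED by the three facts the closer knows about its own
choice and the LH10 «(D-b)ᵀ» Day-X junction reads — (G1) `hΔ`: the kit՚s finite transfer factor IS print՚s `Δ‴` (= `finExplicitCollection …`; through `StubRung0SPinned`՚s
pinned rider), (G3)+ `hloc₀`: at every finite `v` the local transfer DATUM at `(𝔨.Δ_v, 𝔨.m_{H,v}, m_{G,0,v})` (nondegeneracy, admissibility of both families on the
(`G`-)regular classes, Prop. 4.9.1 (a)՚s `Δ_v`-transfer for `C_c^∞` — `IsLocalDeltaTransferExists … IsLocSmooth IsLocSmooth` is `(hloc₀ v).2.2.2`), (G2b) `hcan₀`: the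
export՚s regular family `m_{G,0,v}` is CANONICAL for `W.νG v` (both through the T1 export ★ `anchoredKit_nonempty_of_stubsQ_loc`, T1-API ed. 1.25).  `Rung0Choice`, its
producer `Kit.nonempty_rung0Choice_of` and every consumer (`Rung0Choice.frameData ∕ .rows`, §D.2) are byte-identical; dot-notation on a `Rung0ChoicePinned` reaches them
through `toRung0Choice`. [cite: Rogawski1990, §14.6 Thm. 14.6.1 p. 241; §4.9 Prop. 4.9.1 (a) p. 55; §4.3 (4.3.1)–(4.3.3) pp. 43–44; §1.7 p. 6] -/
structure Rung0ChoicePinned : Type 2 extends Rung0Choice L ι H T hT μ μω hμu hμω where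
  /-- (G1) the kit՚s finite transfer factor is print՚s `Δ‴ = τ·D_{G∕H}·κ` [Rogawski1990, (4.3.1)–(4.3.3) pp. 43–44] -/
  hΔ : 𝔨.Δ = finExplicitCollection L H μω (finExplicitDelta_conj_left_all L H μω) (finExplicitDelta_conj_right_all L H μω)
  /-- (G3)+ the local transfer datum at `(𝔨.Δ_v, 𝔨.m_{H,v}, m_{G,0,v})`, every finite `v` [Rogawski1990, Prop. 4.9.1 (a) p. 55] -/
  hloc₀ : letI : ∀ v : Places L, MeasurableSpace (GpLocal L H v) := fun _ => borel _
    letI : ∀ v : Places L, MeasurableSpace (HLocal L v) := fun _ => borel _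
    letI : ∀ (v : Places L) (a : HLocal L v), MeasurableSpace (HLocal L v ⧸ Subgroup.centralizer ({a} : Set (HLocal L v))) := fun _ _ => borel _
    letI : ∀ (v : Places L) (γ : GpLocal L H v), MeasurableSpace (GpLocal L H v ⧸ Subgroup.centralizer ({γ} : Set (GpLocal L H v))) := fun _ _ => borel _
    ∀ v : Places L, IsLocalTransferDatum L H v (𝔨.Δ v) (𝔨.mH v) (mG₀ v)
  /-- (G2b) the export՚s regular `G′`-family is canonical for `νG_v` [Rogawski1990, §4.3 (4.3.1) p. 43; §1.7 p. 6] -/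
  hcan₀ : letI : ∀ v : Places L, MeasurableSpace (GpLocal L H v) := fun _ => borel _
    haveI : ∀ v : Places L, BorelSpace (GpLocal L H v) := fun _ => ⟨rfl⟩
    letI : ∀ (v : Places L) (γ : GpLocal L H v), MeasurableSpace (GpLocal L H v ⧸ Subgroup.centralizer ({γ} : Set (GpLocal L H v))) := fun _ _ => borel _
    haveI : ∀ (v : Places L) (γ : GpLocal L H v), BorelSpace (GpLocal L H v ⧸ Subgroup.centralizer ({γ} : Set (GpLocal L H v))) := fun _ _ => ⟨rfl⟩
    haveI : ∀ v : Places L, (W.νG v).IsHaarMeasure := W.isHaar_νG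
    haveI : ∀ v : Places L, (W.νG v).IsMulRightInvariant := W.isRightInv_νG
    ∀ v : Places L, (mG₀ v).IsCanonical (fun γ => IsRegularElt (γ.val : GL (Fin 3) (UnitaryGroup.LocalRing L v))) (W.νG v)

variable {L ι H T hT μ μω hμu hμω}

/-- **THE PINNED CHOICE EXISTS — FUNCTION FORM over `h0 : StubRung0SPinned`** (KitD ED. 6; = `Kit.nonempty_rung0Choice_of`՚s body re-patterned on the T1 export
★ `anchoredKit_nonempty_of_stubsQ_loc` fed with the PINNED package of `StubRung0SPinned`: the rider՚s first half is `hΔ`, its `Q_K9S` half builds `hQ`∕`OW` exactly as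
before, the export՚s trailing conjunct gives `hloc₀`∕`hcan₀`).  The aggregator applies it to `Kit.rung0_of_letters_pinned stub_N8 … stub_K9v` at ED. 41 L3.
ED. 7 «#175 PINNED»: through the T1-API ed. 1.26 export ★ `anchoredKit_nonempty_of_stubsQ_loc_pinned` at `Δ₀ := Δ‴(μω)` with the pin `fun _ _ _ h => h.1` (the rider՚s `Δ = Δ‴`), reading
`W.hSET : SingularEllipticTransferCanonicalAtDelta L H W.Tinf Δ‴(μω) …` (Defs ED. 4); `Kit.nonempty_rung0Choice_of` (unpinned) DROPPED.  Body otherwise byte-identical to ED. 6.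
[cite: Rogawski1990, §14.6 Thm. 14.6.1 p. 241; §4.9 Prop. 4.9.1 p. 55] -/
theorem Kit.nonempty_rung0Choice_of_pinned (h0 : StubRung0SPinned)
    (hdef : ∀ τ' : L →+* ℂ, InfinitePlace.mk τ' ≠ InfinitePlace.mk ι → (H.map τ').PosDef) (h2 : 2 ≤ Module.finrank ℚ ↥(maximalRealSubfield L)) :
    Nonempty (Rung0ChoicePinned L ι H T hT μ μω hμu hμω) := by
  obtain ⟨W, hGTQp⟩ := h0 L ι H T hT hdef h2 μ μω hμu hμω
  letI : MeasurableSpace (GpAdelic L H) := borel _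
  haveI : BorelSpace (GpAdelic L H) := ⟨rfl⟩
  haveI : W.ν.IsHaarMeasure := W.isHaar_ν
  haveI : W.ν.IsInvInvariant := W.isInvInv_ν
  letI : ∀ v : Places L, MeasurableSpace (GpLocal L H v) := fun _ => borel _
  haveI : ∀ v : Places L, BorelSpace (GpLocal L H v) := fun _ => ⟨rfl⟩
  letI : ∀ v : Places L, MeasurableSpace (HLocal L v) := fun _ => borel _
  haveI : ∀ v : Places L, BorelSpace (HLocal L v) := fun _ => ⟨rfl⟩
  letI : ∀ (v : Places L) (a : HLocal L v), MeasurableSpace (HLocal L v ⧸ Subgroup.centralizer ({a} : Set (HLocal L v))) := fun _ _ => borel _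
  letI : ∀ (v : Places L) (γ : GpLocal L H v), MeasurableSpace (GpLocal L H v ⧸ Subgroup.centralizer ({γ} : Set (GpLocal L H v))) := fun _ _ => borel _
  letI : MeasurableSpace (GpInf L H) := borel _
  haveI : BorelSpace (GpInf L H) := ⟨rfl⟩
  letI : MeasurableSpace (GInf L) := borel _
  haveI : BorelSpace (GInf L) := ⟨rfl⟩
  letI : MeasurableSpace (HInf L) := borel _
  haveI : BorelSpace (HInf L) := ⟨rfl⟩
  haveI : ∀ v : Places L, (W.νH v).IsHaarMeasure := W.isHaar_νH
  haveI : ∀ v : Places L, (W.νH v).IsMulRightInvariant := W.isRightInv_νH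
  haveI : ∀ v : Places L, (W.νG v).IsHaarMeasure := W.isHaar_νG
  haveI : ∀ v : Places L, (W.νG v).IsMulRightInvariant := W.isRightInv_νG
  haveI : IsFiniteMeasureOnCompacts W.νGi := W.finCpt_νGi
  haveI : W.νGi.IsMulRightInvariant := W.rightInv_νGi
  haveI : IsFiniteMeasureOnCompacts W.νqi := W.finCpt_νqi
  haveI : W.νqi.IsMulRightInvariant := W.rightInv_νqi
  haveI : IsFiniteMeasureOnCompacts W.νHi := W.finCpt_νHi
  haveI : W.νHi.IsMulRightInvariant := W.rightInv_νHi
  have hanis : IsAnisotropic L H := F0P3ClassTokensOfRecord.anisotropic_of_frame L H ι hdef h2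
  have hherm : IsHermitianCM L H := transpose_map_cmConjRingHom_eq_of_frame L ι H T hT
  obtain ⟨𝔨, hpin, htE, hSTF, -, mG₀, hreg, ⟨hΔ, hCM, hall⟩, hlc⟩ :=
    F0T1InnerFormTraceIdentity.anchoredKit_nonempty_of_stubsQ_loc_pinned (μ := μ) W.ν W.νH W.νG W.νGi W.νqi W.νHi
      (stub_T1c_splitFormAutomorphicMeasure L) W.Tinf
      (finExplicitCollection L H μω (finExplicitDelta_conj_left_all L H μω) (finExplicitDelta_conj_right_all L H μω))
      W.hK W.hKH hGTQp (fun _ _ _ h => h.1) W.hAT₄ W.hSET hanis hherm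
  obtain ⟨OW⟩ := hall 𝔨 hpin htE hSTF rfl rfl hreg hCM (stub_Keys L) (stub_79 L)
  exact ⟨{ toRung0Choice := ⟨W, 𝔨, mG₀, hpin, htE, hSTF, hCM, OW⟩, hΔ := hΔ, hloc₀ := fun v => (hlc v).1, hcan₀ := fun v => (hlc v).2 }⟩

variable (C : Rung0Choice L ι H T hT μ μω hμu hμω)

/-- The `FrameData` OF RECORD at a frame, read off the rung-0 choice `C`: sockets `socketsOfT1 (C.𝔨.override C.OW.ov)`, carriers `C.OW.gh`, ξ-side `xiSideOfRecord` at
`(C.𝔨.Δ, C.𝔨.mH, C.mG₀)` with the (J2)∕(J3) glue, sign ∕ arch classes ∕ measures from `C.W` (`archTr := archTr₀ … W.νGi`, `μv := W.νG`) and, ED. 3 (closer ED. 38 «PK-ε»), the root numbers `wXi := C.W.wXi` (★6 (w1) `FrameDataW` = ★ `FrameData` + `wXi`) — so that ★1 `kitOfRecordW` of it IS `kitK9S …` (`rfl`). [cite: Rogawski1992, Thm. 1.2 p. 397] -/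
def Rung0Choice.frameData : F0P3KitOfRecordW.FrameDataW L H ι T hT μ :=
  letI : ∀ v : Places L, MeasurableSpace (GpLocal L H v) := fun _ => borel _
  letI : ∀ v : Places L, MeasurableSpace (HLocal L v) := fun _ => borel _
  letI : ∀ (v : Places L) (a : HLocal L v), MeasurableSpace (HLocal L v ⧸ Subgroup.centralizer ({a} : Set (HLocal L v))) := fun _ _ => borel _
  letI : ∀ (v : Places L) (γ : GpLocal L H v), MeasurableSpace (GpLocal L H v ⧸ Subgroup.centralizer ({γ} : Set (GpLocal L H v))) := fun _ _ => borel _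
  letI : ∀ v : Places L, MeasurableSpace (Gqs L v ⧸ Subgroup.center (Gqs L v)) := fun _ => borel _
  haveI : ∀ v : Places L, BorelSpace (Gqs L v ⧸ Subgroup.center (Gqs L v)) := fun _ => ⟨rfl⟩
  haveI : ∀ v : Places L, (C.W.μZ v).IsHaarMeasure := C.W.isHaar_μZ
  { 𝔰 := socketsOfT1 L H μ (C.𝔨.override C.OW.ov)
    gh := C.OW.gh
    ξd := F0P3XiSideOfRecordSCD.xiSideOfRecordSCD L H (transpose_map_cmConjRingHom_eq_of_frame L ι H T hT) (isUnit_det_of_frame L ι H T hT) μω hμu C.W.μZ (keysOfKeysCaseTwo L μω (stub_Keys L) C.W.μZ (fun v _ => isQuadraticCharExtension_semilocalComponent_of_baseChange_eq μω hμω v))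
            (F0P3XiPacketFamilyOfRecordSCD.hSCD_of_cmCharIdentityPackageTestSigned L H (transpose_map_cmConjRingHom_eq_of_frame L ι H T hT) (isUnit_det_of_frame L ι H T hT) μω hμu
        C.𝔨.Δ C.𝔨.mH C.mG₀ C.W.νG C.W.νH C.W.μZ C.hQ)
            (fun ξ => hexc_of_xiPinSphericalCofinite L μω hμu C.W.μZ (keysOfKeysCaseTwo L μω (stub_Keys L) C.W.μZ (fun v _ => isQuadraticCharExtension_semilocalComponent_of_baseChange_eq μω hμω v)) (fun v _ => isQuadraticCharExtension_semilocalComponent_of_baseChange_eq μω hμω v) (stub_79 L) ξ)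
            C.W.νG C.OW.evpG C.OW.evpH C.OW.ramG C.OW.ramH C.OW.PiXi C.OW.ρXi
    c := C.W.c
    wXi := C.W.wXi
    jInf := C.W.jInf
    dsInf := C.W.dsInf
    archTr := archTr₀ L ι H T hT C.W.νGi
    ν := C.W.ν
    isFiniteMeasureOnCompacts_ν := (show @Measure.IsHaarMeasure (Gp L H).Adelic _ _ (borel _) C.W.ν from C.W.isHaar_ν).toIsFiniteMeasureOnCompacts
    μv := C.W.νG
    isHaarMeasure_μv := C.W.isHaar_νG }

/-- ★1 `kitOfRecordW` of the frame data of record IS `kitK9S …` at the choice (definitional; ED. 3: with the root numbers `wXi`). -/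
theorem Rung0Choice.kitOfRecord_frameData_eq :
    (letI : MeasurableSpace (Gp L H).Adelic := borel _
     haveI : BorelSpace (Gp L H).Adelic := ⟨rfl⟩
     haveI := C.frameData.isFiniteMeasureOnCompacts_ν
     F0P3KitOfRecordW.kitOfRecordW L H ι T hT μ C.frameData.𝔰 C.frameData.gh C.frameData.ξd μω C.frameData.wXi C.frameData.c C.frameData.jInf C.frameData.dsInf C.frameData.archTr C.frameData.ν
       C.frameData.μv F0P3RamClsOfRecord.ramCls₀) =
    kitK9S L ι H T hT μ μω hμu C.W.ν C.W.νH C.W.νG C.W.νGi C.W.μZ C.W.c C.W.wXi C.W.jInf C.W.dsInf C.W.isHaar_ν C.W.isHaar_μZ (fun v _ => isQuadraticCharExtension_semilocalComponent_of_baseChange_eq μω hμω v) C.𝔨.Δ C.𝔨.mH C.mG₀ C.hQ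
      (stub_Keys L) (stub_79 L) C.𝔨 C.OW.ov C.OW.gh C.OW.evpG C.OW.evpH C.OW.ramG C.OW.ramH C.OW.PiXi C.OW.ρXi := rfl

end D

end Summit.HodgeConjecture.HodgeConjecture.Cruxes.H413.F0U3LettersRung1

end


noncomputable section

namespace Summit.HodgeConjecture.HodgeConjecture.Cruxes.H413.F0U3LettersRung1

open MeasureTheory NumberField IsDedekindDomain
open Literature.NumberTheory.Automorphic Literature.NumberTheory.Automorphic.UnitaryGroup
open Literature.NumberTheory.Rogawski1990 Literature.NumberTheory.GaloisRepresentations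
open Summit.HodgeConjecture.HodgeConjecture.Cruxes.H413
open Summit.HodgeConjecture.HodgeConjecture.Cruxes.H413.F0T1InnerFormTraceIdentity (ComparisonKit SpecOverride GpAdelic GpLocal HLocal GpInf GInf HInf IsAnisotropic IsHermitianCM)
open Summit.HodgeConjecture.HodgeConjecture.Cruxes.H413.F0P3InnerFormClassificationV6 (Gp Places Cinf EvpData)
open Summit.HodgeConjecture.HodgeConjecture.Cruxes.H413.F0P3KitOfRecord (kitOfRecord GHSide socketsOfT1 FrameData kitFamilyOfRecord letters_of_specPkgV8
  traceIdentity_kitOfRecord_override)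
open Summit.HodgeConjecture.HodgeConjecture.Cruxes.H413.F0P3XiSideOfRecord (xiSideOfRecord xiFamilyFin_kitOfRecord xiUnram_kitOfRecord_of_xiPinSphericalCofinite evpConvention_kitOfRecord)
open Summit.HodgeConjecture.HodgeConjecture.Cruxes.H413.F0P3XiPacketFamilyOfRecord (keysOfKeysCaseTwo hCM_of_cmCharIdentityPackage hexc_of_xiPinSphericalCofinite)
open Summit.HodgeConjecture.HodgeConjecture.Cruxes.H413.F0P3XiArchPacketOfRecord (JInfNoDegOne DsInfNoDegOne)
open Summit.HodgeConjecture.HodgeConjecture.Cruxes.H413.F0P3UnitaryLocOfRecord (IsCohUnitaryClass)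
open Summit.HodgeConjecture.HodgeConjecture.Cruxes.H413.F0P3LettersTraceFactorisation (IsProductHaar)
open scoped Matrix ComplexOrder

section D2

variable {L : Type} [Field L] [NumberField L] [IsCMField L] {ι : L →+* ℂ} {H : Matrix (Fin 3) (Fin 3) L} {T : GL (Fin 3) ℂ}
  {hT : (T : Matrix (Fin 3) (Fin 3) ℂ)ᴴ * H.map ι * (T : Matrix (Fin 3) (Fin 3) ℂ) = Literature.Geometry.ComplexHyperbolic.BallModel.J}
  {μ : Measure (Gp L H).automorphicQuotient} [(Gp L H).IsAutomorphicMeasure μ] {μω : HeckeCharacter L} {hμu : μω.IsUnitary}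
  {hμω : ∀ x : Literature.NumberTheory.GaloisRepresentations.ideleGroup ↥(maximalRealSubfield L),
    μω (AdeleRing.ideleBaseChange (↥(maximalRealSubfield L)) L x) = quadraticHeckeCharCM L x}
  (C : Rung0Choice L ι H T hT μ μω hμu hμω)

/-- The kit of record AT THE CHOICE (`kitK9S` at `C`'s data; reducible). -/
abbrev Rung0Choice.kit : F0P3InnerFormClassificationV8.ClassificationKit L H ι T hT μ :=
  kitK9S L ι H T hT μ μω hμu C.W.ν C.W.νH C.W.νG C.W.νGi C.W.μZ C.W.c C.W.wXi C.W.jInf C.W.dsInf C.W.isHaar_ν C.W.isHaar_μZ (fun v _ => isQuadraticCharExtension_semilocalComponent_of_baseChange_eq μω hμω v) C.𝔨.Δ C.𝔨.mH C.mG₀ C.hQ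
    (stub_Keys L) (stub_79 L) C.𝔨 C.OW.ov C.OW.gh C.OW.evpG C.OW.evpH C.OW.ramG C.OW.ramH C.OW.PiXi C.OW.ρXi

set_option synthInstance.maxHeartbeats 400000 in
set_option maxHeartbeats 4000000 in
/-- **THE FOURTEEN ROWS AT THE CHOICE՚S KIT — FUNCTION FORM over `hL3 : F0P3CohClassRoutingCot.CohClassRoutingCotClosed`** (= the ED. 33 body of `Rung0Choice.rows`, #15 routing
fed by the binder instead of `stub_L3`; the aggregator՚s `Rung0Choice.rows := C.rows_of stub_L3 …`). ED. 3 (closer ED. 38 «PK-ε»): the kit is the W kit ★1 `kitOfRecordW … C.W.wXi C.W.c …`; `specPkg` (from `C.OW`) and #10 (★1b `unitaryPacket_kitOfRecordW_of`) are the two sign-BEARING rows, the twelve others are the ED. 2 ★ terms, carried to the W kit by ★1՚s structure-update defeq (★1b `…_kitOfRecordW_iff`). [cite: Rogawski1990, §14.6 Thm. 14.6.1 p. 241, Thm. 14.6.4 p. 244] [cite: Rogawski1992, Thm. 1.2 p. 397] -/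
theorem Rung0Choice.rows_of (hL3 : F0P3CohClassRoutingCot.CohClassRoutingCotClosed)
    (hdef : ∀ τ' : L →+* ℂ, InfinitePlace.mk τ' ≠ InfinitePlace.mk ι → (H.map τ').PosDef) (h2 : 2 ≤ Module.finrank ℚ ↥(maximalRealSubfield L)) :
    ∃ S₀ : Finset (Places L),
      F0P3InnerFormClassificationV8.ClassificationKit.SpecPkg C.kit S₀ ∧
      F0P3InnerFormClassificationV6.ClassificationKit.TraceIdentity C.kit ∧
      F0P3InnerFormClassificationV8.ClassificationKit.FactorisationCls C.kit S₀ ∧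
      F0P3InnerFormClassificationV6.ClassificationKit.SpectralSideGp C.kit ∧
      F0P3InnerFormClassificationV8.ClassificationKit.HatBounded C.kit S₀ ∧
      F0P3InnerFormClassificationV8.ClassificationKit.UnrStarAlgebra C.kit S₀ ∧
      F0P3InnerFormClassificationV6.ClassificationKit.LinIndepS C.kit ∧
      F0P3InnerFormClassificationV8.ClassificationKit.UnitaryPacket C.kit S₀ ∧
      F0P3InnerFormClassificationV8.ClassificationKit.Routing C.kit ∧
      JInfNoDegOne C.W.jInf ∧ DsInfNoDegOne C.W.dsInf ∧
      F0P3InnerFormClassificationV6.ClassificationKit.XiFamilyFin C.kit μω hμu ∧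
      F0P3InnerFormClassificationV6.ClassificationKit.XiUnram C.kit ∧
      F0P3InnerFormClassificationV6.ClassificationKit.EvpConvention C.kit := by
  classical
  letI : MeasurableSpace (GpAdelic L H) := borel _
  haveI : BorelSpace (GpAdelic L H) := ⟨rfl⟩
  haveI : C.W.ν.IsHaarMeasure := C.W.isHaar_ν
  haveI : C.W.ν.IsInvInvariant := C.W.isInvInv_ν
  letI : ∀ v : Places L, MeasurableSpace (GpLocal L H v) := fun _ => borel _
  haveI : ∀ v : Places L, BorelSpace (GpLocal L H v) := fun _ => ⟨rfl⟩
  letI : ∀ v : Places L, MeasurableSpace (HLocal L v) := fun _ => borel _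
  haveI : ∀ v : Places L, BorelSpace (HLocal L v) := fun _ => ⟨rfl⟩
  letI : ∀ (v : Places L) (a : HLocal L v), MeasurableSpace (HLocal L v ⧸ Subgroup.centralizer ({a} : Set (HLocal L v))) := fun _ _ => borel _
  letI : ∀ (v : Places L) (γ : GpLocal L H v), MeasurableSpace (GpLocal L H v ⧸ Subgroup.centralizer ({γ} : Set (GpLocal L H v))) := fun _ _ => borel _
  letI : MeasurableSpace (GpInf L H) := borel _
  haveI : BorelSpace (GpInf L H) := ⟨rfl⟩
  letI : MeasurableSpace (GInf L) := borel _
  haveI : BorelSpace (GInf L) := ⟨rfl⟩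
  letI : MeasurableSpace (HInf L) := borel _
  haveI : BorelSpace (HInf L) := ⟨rfl⟩
  haveI : ∀ v : Places L, (C.W.νH v).IsHaarMeasure := C.W.isHaar_νH
  haveI : ∀ v : Places L, (C.W.νH v).IsMulRightInvariant := C.W.isRightInv_νH
  haveI : ∀ v : Places L, (C.W.νG v).IsHaarMeasure := C.W.isHaar_νG
  haveI : ∀ v : Places L, (C.W.νG v).IsMulRightInvariant := C.W.isRightInv_νG
  haveI : IsFiniteMeasureOnCompacts C.W.νGi := C.W.finCpt_νGi
  haveI : C.W.νGi.IsMulRightInvariant := C.W.rightInv_νGi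
  haveI : IsFiniteMeasureOnCompacts C.W.νqi := C.W.finCpt_νqi
  haveI : C.W.νqi.IsMulRightInvariant := C.W.rightInv_νqi
  haveI : IsFiniteMeasureOnCompacts C.W.νHi := C.W.finCpt_νHi
  haveI : C.W.νHi.IsMulRightInvariant := C.W.rightInv_νHi
  -- the `Gp`-spelled copies of the adelic instances, keyed on `borel (GpAdelic L H)` (the σ-algebra the field `W.ν` carries), so that every ★ glue lemma
  -- typed over `(Gp L H).Adelic` finds `BorelSpace` ∕ finiteness after unifying its measure binder with `W.ν` (`cmDatum` vs `adelicGroupData` is not reducible)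
  letI : MeasurableSpace (Gp L H).Adelic := borel (GpAdelic L H)
  haveI : BorelSpace (Gp L H).Adelic := ⟨rfl⟩
  haveI : IsFiniteMeasureOnCompacts (show @Measure (Gp L H).Adelic (borel (GpAdelic L H)) from C.W.ν) :=
    (show @Measure.IsHaarMeasure (Gp L H).Adelic _ _ (borel _) C.W.ν from C.W.isHaar_ν).toIsFiniteMeasureOnCompacts
  haveI : (show @Measure (Gp L H).Adelic (borel (GpAdelic L H)) from C.W.ν).IsHaarMeasure := C.W.isHaar_ν
  letI : MeasurableSpace (Gp L H).Adelic := borel ((Gp L H).Adelic)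
  haveI : BorelSpace (Gp L H).Adelic := ⟨rfl⟩
  haveI : IsFiniteMeasureOnCompacts (show @Measure (Gp L H).Adelic (borel ((Gp L H).Adelic)) from C.W.ν) :=
    (show @Measure.IsHaarMeasure (Gp L H).Adelic _ _ (borel _) C.W.ν from C.W.isHaar_ν).toIsFiniteMeasureOnCompacts
  haveI : (show @Measure (Gp L H).Adelic (borel ((Gp L H).Adelic)) from C.W.ν).IsHaarMeasure := C.W.isHaar_ν
  letI : ∀ v : Places L, MeasurableSpace (Gqs L v ⧸ Subgroup.center (Gqs L v)) := fun _ => borel _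
  haveI : ∀ v : Places L, BorelSpace (Gqs L v ⧸ Subgroup.center (Gqs L v)) := fun _ => ⟨rfl⟩
  haveI : ∀ v : Places L, (C.W.μZ v).IsHaarMeasure := C.W.isHaar_μZ
  have hanis : IsAnisotropic L H := F0P3ClassTokensOfRecord.anisotropic_of_frame L H ι hdef h2
  have hherm : IsHermitianCM L H := transpose_map_cmConjRingHom_eq_of_frame L ι H T hT
  dsimp only [Rung0Choice.kit, kitK9S]
  -- TF: the class factorisation at some level `S₀ᵀᶠ` (★ letter glue + PH)
  obtain ⟨STF, hTF⟩ := F0P3LettersTraceFactorisationS0.traceFactorisation_kitOfRecord L H ι T hT μ (socketsOfT1 L H μ (C.𝔨.override C.OW.ov)) C.OW.gh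
    (F0P3XiSideOfRecordSCD.xiSideOfRecordSCD L H (transpose_map_cmConjRingHom_eq_of_frame L ι H T hT) (isUnit_det_of_frame L ι H T hT) μω hμu C.W.μZ (keysOfKeysCaseTwo L μω (stub_Keys L) C.W.μZ (fun v _ => isQuadraticCharExtension_semilocalComponent_of_baseChange_eq μω hμω v))
       (F0P3XiPacketFamilyOfRecordSCD.hSCD_of_cmCharIdentityPackageTestSigned L H (transpose_map_cmConjRingHom_eq_of_frame L ι H T hT) (isUnit_det_of_frame L ι H T hT) μω hμu
        C.𝔨.Δ C.𝔨.mH C.mG₀ C.W.νG C.W.νH C.W.μZ C.hQ)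
       (fun ξ => hexc_of_xiPinSphericalCofinite L μω hμu C.W.μZ (keysOfKeysCaseTwo L μω (stub_Keys L) C.W.μZ (fun v _ => isQuadraticCharExtension_semilocalComponent_of_baseChange_eq μω hμω v)) (fun v _ => isQuadraticCharExtension_semilocalComponent_of_baseChange_eq μω hμω v) (stub_79 L) ξ)
       C.W.νG C.OW.evpG C.OW.evpH C.OW.ramG C.OW.ramH C.OW.PiXi C.OW.ρXi)
    μω C.W.c C.W.jInf C.W.dsInf C.W.ν C.W.νGi C.W.νG C.W.hPH (stub_TF L H ι T hT hdef h2 μ C.W.ν C.W.νGi C.W.νG)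
  refine ⟨C.OW.S₀ ∪ STF, C.OW.specPkg.mono _ Finset.subset_union_left, ?_, ?_, ?_, ?_, ?_, ?_, ?_, ?_, C.W.hJ, C.W.hD, ?_, ?_, ?_⟩
  · -- #1 `TraceIdentity` = T1's head at the overridden kit; law T1b from the NON-REGULAR residual `stub_T1b` via ★ `IsPinned.ellipticStabilisation_of_lawT1bNonreg` (ED. 5, (V56)(iv))
    rw [F0P3KitOfRecordW.traceIdentity_kitOfRecordW_iff]   -- ED. 3: #1 `TraceIdentity` (v6) is sign-BLIND — transport the W-kit goal to `kitOfRecord … c …` (★1b, `Iff.rfl`) and reuse the ED. 2 ★ term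
    exact traceIdentity_kitOfRecord_override L H ι T hT μ C.𝔨 C.OW.ov C.OW.gh _ μω C.W.c C.W.jInf C.W.dsInf _ C.W.ν C.W.νG _ C.hSTF
      (ComparisonKit.IsPinned.ellipticStabilisation_of_lawT1bNonreg (h := C.hpin) (hanis := hanis) (hherm := hherm)
        (hνG := C.W.isHaar_νG) (hK := C.W.hK) (hνH := C.W.isHaar_νH) (hKH := C.W.hKH) (ha := C.hSTF)
        (hnon := stub_T1b L H hherm hanis μ C.W.ν C.W.νH C.W.νG C.W.νGi C.W.νqi C.W.νHi C.W.Tinf C.𝔨 C.hpin))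
      C.htE C.OW.specPkgT1
  · -- TF, class conjunct, lifted to `S₀`
    rw [F0P3KitOfRecordW.factorisationCls₈_kitOfRecordW_iff]   -- ED. 3: TF `FactorisationCls S₀` (v8) is sign-BLIND — transport the W-kit goal to `kitOfRecord … c …` (★1b, `Iff.rfl`) and reuse the ED. 2 ★ term
    exact fun S c fS fT hS => hTF S (Finset.subset_union_right.trans hS) c fS fT
  · -- #2 `SpectralSideGp` from «SSG» + pin (v)
    rw [F0P3KitOfRecordW.spectralSideGp_kitOfRecordW_iff]   -- ED. 3: #2 `SpectralSideGp` (v6) is sign-BLIND — transport the W-kit goal to `kitOfRecord … c …` (★1b, `Iff.rfl`) and reuse the ED. 2 ★ term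
    refine F0P3LettersSpectralSideGp.spectralSideGp_kitOfRecord L H ι T hT μ (socketsOfT1 L H μ (C.𝔨.override C.OW.ov)) C.OW.gh _ μω C.W.c C.W.jInf
      C.W.dsInf _ C.W.ν C.W.νG _ hanis (stub_SSG L H μ C.W.ν hanis) ?_
    intro F
    rw [show (socketsOfT1 L H μ (C.𝔨.override C.OW.ov)).traceGp = C.𝔨.traceGp from rfl,
      ComparisonKit.IsPinned.traceGp_eq (h := C.hpin) (hanis := hanis)]
  · -- #6 `HatBounded S₀` at BOTH summands, IN-HOUSE from the pins + the packet ANCHORS (ED. 6; ★ B-p12 `hatBounded_kitOfRecord_of_anchored`)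
    refine F0P3InnerFormClassificationV8.ClassificationKit.HatBounded.mono Finset.subset_union_left ?_
    rw [F0P3KitOfRecordW.hatBounded₈_kitOfRecordW_iff]   -- ED. 3: #6 `HatBounded S₀` (v8) is sign-BLIND — transport the W-kit goal to `kitOfRecord … c …` (★1b, `Iff.rfl`) and reuse the ED. 2 ★ term
    apply F0P3HatLawsKitK9.hatBounded_kitOfRecord_of_anchored
    · exact hdef
    · exact h2
    · exact C.W.isHaar_νG
    · exact C.OW.anchorG
    · exact C.OW.anchorH
  · -- #7 `UnrStarAlgebra S₀` at BOTH summands, IN-HOUSE (ED. 6; ★ B-p12 `unrStarAlgebra_kitOfRecord_of_anchored`)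
    refine F0P3InnerFormClassificationV8.ClassificationKit.UnrStarAlgebra.mono Finset.subset_union_left ?_
    rw [F0P3KitOfRecordW.unrStarAlgebra₈_kitOfRecordW_iff]   -- ED. 3: #7 `UnrStarAlgebra S₀` (v8) is sign-BLIND — transport the W-kit goal to `kitOfRecord … c …` (★1b, `Iff.rfl`) and reuse the ED. 2 ★ term
    apply F0P3HatLawsKitK9.unrStarAlgebra_kitOfRecord_of_anchored
    · exact hdef
    · exact h2
    · exact C.W.isHaar_νG
    · exact C.OW.anchorG
    · exact C.OW.anchorH
  · -- #8 `LinIndepS` from (L2-SA)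
    rw [F0P3KitOfRecordW.linIndepS_kitOfRecordW_iff]   -- ED. 3: #8 `LinIndepS` (v6) is sign-BLIND — transport the W-kit goal to `kitOfRecord … c …` (★1b, `Iff.rfl`) and reuse the ED. 2 ★ term
    exact F0P3LettersLinIndepS.linIndepS_kitOfRecord L H ι T hT μ (socketsOfT1 L H μ (C.𝔨.override C.OW.ov)) C.OW.gh _ μω C.W.c C.W.jInf C.W.dsInf
      C.W.νGi C.W.ν C.W.νG _ (stub_L2SA L ι H T hT C.W.νGi C.W.νG) hdef C.W.hPH.isHaarMeasure_arch C.W.isHaar_νG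
  · -- #10 `UnitaryPacket S₀` from XLPU + the coh-unitarity of the arch classes (v6 text AT THE W KIT via ★1b, then the v8 guard)
    refine F0P3InnerFormClassificationV8.ClassificationKit.unitaryPacket_of_v6 _ ?_ _
    apply F0P3KitOfRecordW.unitaryPacket_kitOfRecordW_of   -- ED. 3: ★7 «UP-W» (★1b p847021) — row #10 reads `expansion ≠ 0`, sign-BEARING, so it is re-proved AT THE W KIT (same three inputs)
    · apply F0P3XiSideOfRecordSCD.hFinU_xiSideOfRecordSCD
      exact stub_XLPU L H (transpose_map_cmConjRingHom_eq_of_frame L ι H T hT) (isUnit_det_of_frame L ι H T hT) μω hμu hμω C.W.μZ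
        (keysOfKeysCaseTwo L μω (stub_Keys L) C.W.μZ (fun v _ => isQuadraticCharExtension_semilocalComponent_of_baseChange_eq μω hμω v))
    · exact C.W.hJU
    · exact C.W.hDU
  · -- #15 `Routing`, GUARDED v8 text, from the guarded letter (L3′)-cot = the T2 head BY NAME (ED. 5, RULING (V54)(3))
    rw [F0P3KitOfRecordW.routing₈_kitOfRecordW_iff]   -- ED. 3: #15 `Routing` (v8) is sign-BLIND — transport the W-kit goal to `kitOfRecord … c …` (★1b, `Iff.rfl`) and reuse the ED. 2 ★ term
    apply F0T2RoutingKitOfRecordOfCotSCD.routing₈_kitOfRecordSCD_of_cot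
    exact hL3 L ι H T hT (transpose_map_cmConjRingHom_eq_of_frame L ι H T hT) (isUnit_det_of_frame L ι H T hT) hdef h2 μ μω hμu hμω C.W.μZ
      (keysOfKeysCaseTwo L μω (stub_Keys L) C.W.μZ (fun v _ => isQuadraticCharExtension_semilocalComponent_of_baseChange_eq μω hμω v))
  · -- #20 `XiFamilyFin`
    rw [F0P3KitOfRecordW.xiFamilyFin_kitOfRecordW_iff]   -- ED. 3: #20 `XiFamilyFin` (v6) is sign-BLIND — transport the W-kit goal to `kitOfRecord … c …` (★1b, `Iff.rfl`) and reuse the ED. 2 ★ term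
    apply F0P3XiSideOfRecordSCD.xiFamilyFin_kitOfRecordSCD
  · -- #21 `XiUnram` from #79 + `hquad`
    rw [F0P3KitOfRecordW.xiUnram_kitOfRecordW_iff]   -- ED. 3: #21 `XiUnram` (v6) is sign-BLIND — transport the W-kit goal to `kitOfRecord … c …` (★1b, `Iff.rfl`) and reuse the ED. 2 ★ term
    apply F0P3XiSideOfRecordSCD.xiUnram_kitOfRecordSCD_of_xiPinSphericalCofinite
    · exact (fun v _ => isQuadraticCharExtension_semilocalComponent_of_baseChange_eq μω hμω v)
    · exact stub_79 L
    · exact C.W.isHaar_νG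
  · -- #23 `EvpConvention` from the override's junk conventions
    rw [F0P3KitOfRecordW.evpConvention_kitOfRecordW_iff]   -- ED. 3: #23 `EvpConvention` (v6) is sign-BLIND — transport the W-kit goal to `kitOfRecord … c …` (★1b, `Iff.rfl`) and reuse the ED. 2 ★ term
    apply F0P3XiSideOfRecordSCD.evpConvention_kitOfRecordSCD
    · exact C.OW.hG
    · exact C.OW.hH'

end D2

end Summit.HodgeConjecture.HodgeConjecture.Cruxes.H413.F0U3LettersRung1

end
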